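import Mathlib
import HarnessLib
import Summits.Ventures.LatticeQCDFlow.Exactness.KickedProductSequence

/-!
# The OMF2 step in a normed algebra is a step-indexed kicked product: `K(G₁) D(δ) K(G₂) D(δ) K(G₁)` iterated `n` times has the half-step trajectory `plfSeqTraj` with merged kicks `G₁, G₂, 2G₁, G₂, 2G₁, …` — step 3 of the OMF ergodicity roadmap (R1)

HONEST FRAMING: exact (Metropolis-corrected) sampling algorithms for lattice gauge theory;
figures of merit are autocorrelation/cost numbers at stated couplings and volumes; no
continuum-physics claim.

Venture `LatticeQCDFlow` (cell pub-lqcd), topic `Exactness`, FANOUT row 9 (eng-latcore, GEN-25; the engine's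
`hmc.HMC(f, β, 'omf2').trajectory(τ, nstep, tau_jitter)` on 4D `SU(N)`: per step `P += λε F; U ← e^{(ε/2)P}U; P += (1−2λ)ε F;
U ← e^{(ε/2)P}U; P += λε F`).  NEW WORK of the cell over GEN-25's `KickedProductSequence.lean` (`plfSeqTraj`, `PLFSeqBounds`)
and gen-18's `KickedProductTrajectory.lean` (`PLFBounds`).  Pure algebra (Mathlib only); nothing is cited as a fact; no number
is claimed.  The `SU(N)` reading (the engine's `omf2Word` through gen-18's `sunEmbed`) and the position law are the next
files of the roadmap (HANDOFF.md GEN-25 «R1 ROADMAP»).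

## Content

* `plfOmf2Step ex J G₁ G₂ δ` — ONE OMF2 step in the algebra: `(W, m) ↦` kick `G₁`, drift `ex (δ • J m)·`, kick `G₂`, drift,
  kick `G₁` (`δ` = the half step `ε/2` of the engine; the kick maps carry their coefficients).
* `omf2Kicks G₁ G₂ : ℕ → 𝔸 → V` — the MERGED kick sequence `G₁, G₂, 2G₁, G₂, 2G₁, …` (index `0`: `G₁`; odd: `G₂`; even
  `≥ 2`: `2G₁`).
* **`plfOmf2Step_iterate`** — `(plfOmf2Step)^[n] (1, p) = (W_{2n}, m_{2n} − G₁ W_{2n})` with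
  `(W_k, m_k) = plfSeqTraj ex J (omf2Kicks G₁ G₂) (fun _ => δ) p k`: the `n`-step OMF2 trajectory IS the step-indexed kicked
  product of `KickedProductSequence` with `2n` drift factors — so `plfSeqTraj_two_point` / `plfSeqTraj_fst_approx`
  (`KickedProductSequenceTwoPoint`) apply to it.
* **`PLFSeqBounds.omf2`** — if `G₁`, `G₂` are bounded by `b₁`, `b₂` and `K₁`-, `K₂`-Lipschitz on the group `T` (with gen-18's
  hypotheses on `ex`, `J`, `T`), the merged sequence satisfies `PLFSeqBounds` with `b = max (2b₁) b₂`, `K = max (2K₁) K₂`.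

NOT CLAIMED: OMF4 (variable drift lengths — needs the `Σ δs` form of the two-point estimate); any group, measure or kernel;
floating point.
-/

noncomputable section

namespace Summit.Ventures.LatticeQCDFlow.Exactness

open Set NNReal Function

variable {𝔸 : Type*} [NormedRing 𝔸] [NormedAlgebra ℝ 𝔸]
variable {V : Type*} [NormedAddCommGroup V] [NormedSpace ℝ V]

/-! ## §1 The OMF2 step and its merged kick sequence -/

section Defs

variable (ex : 𝔸 → 𝔸) (J : V →L[ℝ] 𝔸) (G₁ G₂ : 𝔸 → V) (δ : ℝ)

/-- **ONE OMF2 STEP IN THE ALGEBRA** `K(G₁) D(δ) K(G₂) D(δ) K(G₁)`: kick `m ← m + G₁ W`, drift `W ← ex (δ • J m) · W`,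
kick `m ← m + G₂ W`, drift, kick `m ← m + G₁ W`. -/
def plfOmf2Step (z : 𝔸 × V) : 𝔸 × V :=
  let m₁ := z.2 + G₁ z.1
  let W₁ := ex (δ • J m₁) * z.1
  let m₂ := m₁ + G₂ W₁
  let W₂ := ex (δ • J m₂) * W₁
  (W₂, m₂ + G₁ W₂)

/-- **THE MERGED KICK SEQUENCE OF THE OMF2 WORD**: `G₁` at index `0`, `G₂` at odd indices, `2G₁` at even indices `≥ 2`
(the end kick of a step merges with the start kick of the next). -/
def omf2Kicks : ℕ → 𝔸 → V := fun k =>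
  if k = 0 then G₁ else if k % 2 = 1 then G₂ else fun W => (2 : ℝ) • G₁ W

omit [NormedRing 𝔸] [NormedAlgebra ℝ 𝔸] in
/-- Index `0`. -/
@[simp] theorem omf2Kicks_zero : omf2Kicks G₁ G₂ 0 = G₁ := by simp [omf2Kicks]

omit [NormedRing 𝔸] [NormedAlgebra ℝ 𝔸] in
/-- Odd indices carry `G₂`. -/
theorem omf2Kicks_odd (j : ℕ) : omf2Kicks G₁ G₂ (2 * j + 1) = G₂ := by
  have h2 : (2 * j + 1) % 2 = 1 := by omega
  simp [omf2Kicks, h2]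

omit [NormedRing 𝔸] [NormedAlgebra ℝ 𝔸] in
/-- Even indices `≥ 2` carry `2G₁`. -/
theorem omf2Kicks_even_succ (j : ℕ) : omf2Kicks G₁ G₂ (2 * j + 2) = fun W => (2 : ℝ) • G₁ W := by
  simp [omf2Kicks]

variable (p : V)

/-- **THE `n`-STEP OMF2 TRAJECTORY IS THE STEP-INDEXED KICKED PRODUCT WITH `2n` DRIFT FACTORS**:
`(plfOmf2Step)^[n] (1, p) = (W_{2n}, m_{2n} − G₁ W_{2n})`, `(W_k, m_k) = plfSeqTraj ex J (omf2Kicks G₁ G₂) (fun _ => δ) p k`. -/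
theorem plfOmf2Step_iterate (n : ℕ) :
    (plfOmf2Step ex J G₁ G₂ δ)^[n] (1, p) =
      ((plfSeqTraj ex J (omf2Kicks G₁ G₂) (fun _ => δ) p (2 * n)).1,
        (plfSeqTraj ex J (omf2Kicks G₁ G₂) (fun _ => δ) p (2 * n)).2 -
          G₁ (plfSeqTraj ex J (omf2Kicks G₁ G₂) (fun _ => δ) p (2 * n)).1) := by
  induction n with
  | zero => simp [plfSeqTraj]
  | succ n ih =>
    rw [Function.iterate_succ_apply', ih]
    -- abbreviate the trajectory at `2n`, `2n+1`, `2n+2`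
    have hmul : 2 * (n + 1) = 2 * n + 1 + 1 := by ring
    set W := (plfSeqTraj ex J (omf2Kicks G₁ G₂) (fun _ => δ) p (2 * n)).1 with hW
    set m := (plfSeqTraj ex J (omf2Kicks G₁ G₂) (fun _ => δ) p (2 * n)).2 with hm
    have h1f : (plfSeqTraj ex J (omf2Kicks G₁ G₂) (fun _ => δ) p (2 * n + 1)).1 = ex (δ • J m) * W :=
      plfSeqTraj_succ_fst ex J _ _ p (2 * n)
    have h1s : (plfSeqTraj ex J (omf2Kicks G₁ G₂) (fun _ => δ) p (2 * n + 1)).2 = m + G₂ (ex (δ • J m) * W) := by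
      rw [plfSeqTraj_succ_snd, h1f, omf2Kicks_odd]
    have h2f : (plfSeqTraj ex J (omf2Kicks G₁ G₂) (fun _ => δ) p (2 * n + 1 + 1)).1 =
        ex (δ • J (m + G₂ (ex (δ • J m) * W))) * (ex (δ • J m) * W) := by
      rw [plfSeqTraj_succ_fst, h1s, h1f]
    have h2s : (plfSeqTraj ex J (omf2Kicks G₁ G₂) (fun _ => δ) p (2 * n + 1 + 1)).2 =
        m + G₂ (ex (δ • J m) * W) + (2 : ℝ) • G₁ (ex (δ • J (m + G₂ (ex (δ • J m) * W))) * (ex (δ • J m) * W)) := by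
      rw [plfSeqTraj_succ_snd, h2f, h1s, show 2 * n + 1 + 1 = 2 * n + 2 by ring, omf2Kicks_even_succ]
    rw [hmul, h2f, h2s]
    simp only [plfOmf2Step, sub_add_cancel, two_smul, Prod.mk.injEq, true_and]
    abel

/-- The configuration after `n` OMF2 steps is `W_{2n}`. -/
theorem plfOmf2Step_iterate_fst (n : ℕ) :
    ((plfOmf2Step ex J G₁ G₂ δ)^[n] (1, p)).1 = (plfSeqTraj ex J (omf2Kicks G₁ G₂) (fun _ => δ) p (2 * n)).1 := by
  rw [plfOmf2Step_iterate]

/-- The momentum after `n` OMF2 steps is `m_{2n} − G₁ W_{2n}`. -/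
theorem plfOmf2Step_iterate_snd (n : ℕ) :
    ((plfOmf2Step ex J G₁ G₂ δ)^[n] (1, p)).2 =
      (plfSeqTraj ex J (omf2Kicks G₁ G₂) (fun _ => δ) p (2 * n)).2 -
        G₁ (plfSeqTraj ex J (omf2Kicks G₁ G₂) (fun _ => δ) p (2 * n)).1 := by
  rw [plfOmf2Step_iterate]

end Defs

/-! ## §2 Bounds on the merged kicks from bounds on `G₁`, `G₂` -/

section Bounds

variable {ex : 𝔸 → 𝔸} {J : V →L[ℝ] 𝔸} {G₁ G₂ : 𝔸 → V} {T : Set 𝔸} {C b₁ b₂ K₁ K₂ ρ η : ℝ}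

/-- **THE MERGED OMF2 KICKS SATISFY THE STANDING HYPOTHESES** with `b = max (2b₁) b₂`, `K = max (2K₁) K₂`, whenever
`G₁` does with `(b₁, K₁)` (gen-18's `PLFBounds`, which also carries the hypotheses on `ex`, `J`, `T`) and `G₂` is bounded by
`b₂` and `K₂`-Lipschitz on `T` (`K₂ ≥ 0`). -/
theorem PLFSeqBounds.omf2 (h₁ : PLFBounds ex J G₁ T C b₁ K₁ ρ η) (hb₂ : ∀ W ∈ T, ‖G₂ W‖ ≤ b₂)
    (hK₂ : ∀ W ∈ T, ∀ W' ∈ T, ‖G₂ W - G₂ W'‖ ≤ K₂ * ‖W - W'‖) (hK₂0 : 0 ≤ K₂) :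
    PLFSeqBounds ex J (omf2Kicks G₁ G₂) T C (max (2 * b₁) b₂) (max (2 * K₁) K₂) ρ η where
  one_mem := h₁.one_mem
  mul_mem := h₁.mul_mem
  norm_le := h₁.norm_le
  one_le := h₁.one_le
  force_le k W hW := by
    have hb := h₁.force_bound_nonneg
    rcases Nat.even_or_odd k with ⟨j, hj⟩ | ⟨j, hj⟩
    · rcases j with _ | j
      · simp only [hj, add_zero, omf2Kicks_zero]
        exact (h₁.force_le W hW).trans ((by linarith : b₁ ≤ 2 * b₁).trans (le_max_left _ _))
      · rw [hj, show j + 1 + (j + 1) = 2 * j + 2 by ring, omf2Kicks_even_succ]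
        dsimp only
        rw [norm_smul, Real.norm_two]
        exact (mul_le_mul_of_nonneg_left (h₁.force_le W hW) zero_le_two).trans (le_max_left _ _)
    · rw [hj, omf2Kicks_odd]
      exact (hb₂ W hW).trans (le_max_right _ _)
  force_lip k W hW W' hW' := by
    have hK := h₁.lip_nonneg
    have hn : 0 ≤ ‖W - W'‖ := norm_nonneg _
    rcases Nat.even_or_odd k with ⟨j, hj⟩ | ⟨j, hj⟩
    · rcases j with _ | j
      · simp only [hj, add_zero, omf2Kicks_zero]
        refine (h₁.force_lip W hW W' hW').trans (mul_le_mul_of_nonneg_right ?_ hn)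
        exact (by linarith : K₁ ≤ 2 * K₁).trans (le_max_left _ _)
      · rw [hj, show j + 1 + (j + 1) = 2 * j + 2 by ring, omf2Kicks_even_succ]
        dsimp only
        rw [← smul_sub, norm_smul, Real.norm_two]
        calc 2 * ‖G₁ W - G₁ W'‖ ≤ 2 * (K₁ * ‖W - W'‖) := mul_le_mul_of_nonneg_left (h₁.force_lip W hW W' hW') zero_le_two
          _ = (2 * K₁) * ‖W - W'‖ := by ring
          _ ≤ max (2 * K₁) K₂ * ‖W - W'‖ := mul_le_mul_of_nonneg_right (le_max_left _ _) hn
    · rw [hj, omf2Kicks_odd]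
      exact (hK₂ W hW W' hW').trans (mul_le_mul_of_nonneg_right (le_max_right _ _) hn)
  lip_nonneg := hK₂0.trans (le_max_right _ _)
  ex_zero := h₁.ex_zero
  ex_defect := h₁.ex_defect
  defect_nonneg := h₁.defect_nonneg
  defect_le_one := h₁.defect_le_one
  radius_nonneg := h₁.radius_nonneg

end Bounds

end Summit.Ventures.LatticeQCDFlow.Exactness

end
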